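import Literature.MathematicalPhysics.QuantumLattice.FermiRG.FST2Hypotheses
import Literature.MathematicalPhysics.QuantumLattice.FermiRG.FST3Main
import HarnessLib

/-!
# Dictionary between the two typings of the Feldman–Salmhofer–Trubowitz hypotheses
# (`FST2Hypotheses.lean`: (A1)–(A5), (Sy) of FST II; `FST3Main.lean`: (H1)–(H5), (Sy), (H4), (H4') of FST III)

FST II (CPAM 51 (1998) 1133 = arXiv:cond-mat/9701073, §2.1) and FST III (CPAM 52 (1999) 273 =
arXiv:cond-mat/9705272, §1) print the same hypotheses on `(e, v̂)` ("We use the following assumptions …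
(not all assumptions are needed in all parts of the proof)", FST III p.1; "(H4) and (H4') (stated in
Chapter 2 of II)", p.2). The gate-hubbard-kl typer wave typed them twice, concurrently: `HypA1 … HypA5`,
`HypSy`, `GeomConstants` over a `Crystal` and a bare `e : E → ℝ` (t4), and `FST3.H1 … FST3.H5`, `FST3.Sy`,
`FST3.Admits` over an `FST3.Model d` record (t5). This file records, as PROVED lemmas, where the two
typings coincide literally, so that a consumer holding one form can feed the other:

* the Fermi surface, the Hessian form and (Sy) are the same objects (`fermiSurface_eq`, `hessQuad_eq`,
  `sy_iff_hypSy`);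
* (H3) of `FST3Main` and (A3) of `FST2Hypotheses` are the same predicate (`h3_iff_hypA3`);
* the antipode relations agree at points with non-vanishing gradients (`isAntipode_iff`), the only
  points either paper considers ((H2)/(A2): `∇e ≠ 0` on `S`);
* the geometric clauses of `FST3.Admits` give those of `GeomConstants` (`Admits.le_norm_gradient`,
  `Admits.le_hessQuad`).

NOT bridged here (different encodings, recorded for the referee): the `C^{k,h}` norms — `FST3Main` bounds
the coordinate partials `Σ_{|α|≤k} sup |∂^α f|` as printed in FST III (1.1)–(1.2), `FST2Hypotheses` uses
the tree's `MemContDiffHolder` (operator norms of `iteratedFDeriv`); (H4)/(A4) (curves of antipodes vs an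
antipodal self-map), (H4')/(A4') (`deriv` of the angular antipode vs the curvature ratio (curvratio)) and
(H5)/(A5) (`FST3.Model.fund` vs `Crystal.fundamentalDomain`) are equivalent only up to those
repackagings and are left to the consumer that fixes a crystal. [cite: FeldmanSalmhoferTrubowitz1999, §1 p.1-2]
-/

noncomputable section

namespace Literature.MathematicalPhysics.QuantumLattice.FermiRG

namespace FST3

variable {d : ℕ}

/-- The two Fermi-surface sets coincide: `FST3.Model.fermiSurface M = fermiSurface M.e = {e = 0}`.
[cite: FeldmanSalmhoferTrubowitz1999, §1 p.1] -/
theorem fermiSurface_eq (M : Model d) : M.fermiSurface = fermiSurface M.e := by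
  ext p
  simp [Model.fermiSurface, fermiSurface]

/-- The two Hessian quadratic forms are the same term. [cite: FeldmanSalmhoferTrubowitz1999, §1 p.2] -/
theorem hessQuad_eq (e : Mom d → ℝ) (p t : Mom d) : FST3.hessQuad e p t = FermiRG.hessQuad e p t := rfl

/-- (Sy) of FST III §1 is (Sy) of FST II §2.1. [cite: FeldmanSalmhoferTrubowitz1999, §1 (Sy) p.2] -/
theorem sy_iff_hypSy (M : Model d) : Sy M ↔ HypSy M.e := Iff.rfl

/-- (H3) of FST III §1 is (A3) of FST II §2.1 (same orientation convention: `(t, e'' t) > 0` on tangent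
vectors, Fermi sea convex). [cite: FeldmanSalmhoferTrubowitz1999, §1 (H3) p.2] -/
theorem h3_iff_hypA3 (M : Model d) : H3 M ↔ HypA3 M.e := by
  unfold H3 HypA3
  rw [fermiSurface_eq]
  constructor
  · intro h p hp v hv h0
    exact h p hp v hv (by rwa [real_inner_comm])
  · intro h p hp t ht h0
    exact h p hp t ht (by rwa [real_inner_comm])

/-- At points with non-vanishing gradients the two antipode relations agree: `FST3.Model.IsAntipode`
(`|∇e(p)| ∇e(q) = -|∇e(q)| ∇e(p)`) iff `IsAntipode` of `FST2Hypotheses` (`n(q) = -n(p)` for the unit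
normals). [cite: FeldmanSalmhoferTrubowitz1999, §1 p.2] -/
theorem isAntipode_iff (M : Model d) {p q : Mom d} (hp : gradient M.e p ≠ 0)
    (hq : gradient M.e q ≠ 0) : M.IsAntipode p q ↔ FermiRG.IsAntipode M.e p q := by
  have hnp : ‖gradient M.e p‖ ≠ 0 := norm_ne_zero_iff.mpr hp
  have hnq : ‖gradient M.e q‖ ≠ 0 := norm_ne_zero_iff.mpr hq
  simp only [Model.IsAntipode, FermiRG.IsAntipode, unitNormal, mem_fermiSurface]
  constructor
  · rintro ⟨h1, h2, h3⟩
    refine ⟨h1, h2, ?_⟩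
    have key : (‖gradient M.e p‖ * ‖gradient M.e q‖) • (‖gradient M.e q‖⁻¹ • gradient M.e q) =
        (‖gradient M.e p‖ * ‖gradient M.e q‖) • (-(‖gradient M.e p‖⁻¹ • gradient M.e p)) := by
      rw [smul_smul, smul_neg, smul_smul, mul_assoc, mul_inv_cancel₀ hnq, mul_one,
        mul_comm ‖gradient M.e p‖, mul_assoc, mul_inv_cancel₀ hnp, mul_one, h3]
    exact smul_right_injective _ (mul_ne_zero hnp hnq) key
  · rintro ⟨h1, h2, h3⟩
    refine ⟨h1, h2, ?_⟩
    have key := congrArg (fun v => (‖gradient M.e p‖ * ‖gradient M.e q‖) • v) h3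
    simp only [smul_smul, smul_neg] at key
    rwa [mul_assoc, mul_inv_cancel₀ hnq, mul_one, mul_comm ‖gradient M.e p‖, mul_assoc,
      mul_inv_cancel₀ hnp, mul_one] at key

/-- The gradient clause of `FST3.Admits` (FST III §1 (1): `|∇e| > g₀` on `{|e| < r₀}`) gives the
(non-strict) clause `le_norm_gradient` of `GeomConstants` ((gzerinit) of FST II).
[cite: FeldmanSalmhoferTrubowitz1999, §1 p.2] -/
theorem Admits.le_norm_gradient {M : Model d} {c : RegularityData} (h : Admits M c) (p : Mom d)
    (hp : |M.e p| < c.r₀) : c.g₀ ≤ ‖gradient M.e p‖ :=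
  le_of_lt (h.2.2.2.2.2.1 p hp)

/-- The curvature clause of `FST3.Admits` (FST III §1 (3)) is the clause `le_hessQuad` of `GeomConstants`
(FST II Lemma 2.1 / (wz)), up to the symmetry of the inner product.
[cite: FeldmanSalmhoferTrubowitz1999, §1 p.2] -/
theorem Admits.le_hessQuad {M : Model d} {c : RegularityData} (h : Admits M c) (p : Mom d)
    (hp : |M.e p| < c.r₀) (t : Mom d) (ht : inner ℝ (gradient M.e p) t = 0) :
    c.w₀ * ‖t‖ ^ 2 ≤ FermiRG.hessQuad M.e p t :=
  h.2.2.2.2.2.2 p hp t (by rwa [real_inner_comm])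

/-- Hence: if `M` admits the data `c` and `K` bounds the operator norms of `D^j e`, `j ≤ 2`, then
`(K, r₀, g₀, w₀)` are geometric constants of `e` in the sense of `FST2Hypotheses.GeomConstants`.
[cite: FeldmanSalmhoferTrubowitz1999, §1 p.2] -/
theorem Admits.geomConstants {M : Model d} {c : RegularityData} (h : Admits M c) {K : ℝ}
    (hK : ∀ p : Mom d, ∀ j ≤ 2, ‖iteratedFDeriv ℝ j M.e p‖ ≤ K) :
    GeomConstants M.e K c.r₀ c.g₀ c.w₀ where
  r₀_pos := h.2.2.1
  g₀_pos := h.2.2.2.1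
  wmin_pos := h.2.2.2.2.1
  norm_iteratedFDeriv_le := hK
  le_norm_gradient := h.le_norm_gradient
  le_hessQuad := h.le_hessQuad

end FST3

end Literature.MathematicalPhysics.QuantumLattice.FermiRG
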